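import Summits.CriticalPhenomena.PercolationContinuityZ3.Theorems.PercNearOneGluingNoHeavyLowerTailThreePointLBSwitchingCertificate
import HarnessLib

/-!
# `NoHeavyLowerTail` (stmt-CriticalPhenomena-4575) — GROUP three-point lower bound `GRP3PTLB`, III:
# the finite certificate check and the cubic identity (graph-free)

Support file (prover prim-ineq-prove-3, gen 5; `--supports stmt-CriticalPhenomena-4575`).  No named facts, no sorries.

The two graph-free ingredients of the proof of `GRP3PTLB` (this seat's FINDING-GRP3PTLB.md; prim-lit-2's
PROOF-3PTLB.md "Variant C" certificate for vertex sets):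
* `certB_nonpos` / `certP_nonpos` — **the pointwise lemma, abstract form.**  After the cluster facts F1–F4 for
  unions of clusters (file `…GroupThreePointLBClusters`) rewrite the memberships of the outputs of the four
  switchings `Ψ₁, Ψ₂, Ψ₃, Ψ₄′`, the pointwise sum of potentials
  `S = λ₀ + λ₁∘Ψ₁ + λ₂∘Ψ₂ + λ₃∘Ψ₃ + λ₄′∘Ψ₄′` is a signed sum of seven indicator monomials in ELEVEN atomic
  statements — `xAB, xAc, xBc` (group connections `A~B`, `A~c`, `B~c` in copy `X`), `yBc`, `zAc`,
  `yA = [B ~ c by Y-pairs avoiding clS X A]`, `zB = [A ~ c by Z-pairs avoiding clS X B]`, and the four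
  connections `s3a, s3b, s4a, s4b` of `c` resp. `B` inside the two-region outputs — and transitivity THROUGH THE
  VERTEX `c` plus F4 supply seven implications.  `certB_nonpos`: on all Boolean patterns satisfying them the sum
  is `≤ 0` (`decide`; 550 admissible patterns); `certP_nonpos`: the same for propositions (`ThreePointLB.pind`).
* `cert_identity` — the expectation of `S` equals `−E₃` as a FREE cubic identity in six event probabilities
  (`q = P(Q)`, `sA, sB, sC` the three "one group separated from both others" cells, `x = P(D[B|c])`,
  `y = P(D[A|c])`), once `P(D[A|B]) = sA + sB − q` (the only place where `c` being ONE vertex enters: the pattern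
  `c ~ A, c ~ B, A ≁ B` is empty) is substituted (`ring`).
-/

noncomputable section

namespace Summit.CriticalPhenomena.PercolationContinuityZ3.Theorems

namespace GroupThreePointLB

open ThreePointLB

/-! ### The finite certificate check -/

/-- The pointwise certificate of `GRP3PTLB` as a function of the eleven Boolean atoms (see
`GroupThreePointLB.cert_nonpos`): `λ₀ = [X∈Pa][¬yBc][zAc] + [X∈Pb][yBc][¬zAc] − [X∈Q][¬yBc][¬zAc]`,
`λ₁∘Ψ₁ = −[¬xAB ∧ ¬xAc ∧ ¬yA][zAc]`, `λ₂∘Ψ₂ = −[yBc][¬xAB ∧ ¬zB ∧ ¬xBc]`,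
`λ₃∘Ψ₃ = [¬xAB ∧ ¬xAc ∧ yA][¬s3a ∧ ¬s3b]`, `λ₄′∘Ψ₄′ = [¬s4a ∧ ¬s4b][¬xAc ∧ ¬xBc]`. [this work] -/
def certB (xAB xAc xBc yBc zAc yA zB s3a s3b s4a s4b : Bool) : ℤ :=
  bI ((xBc && (!xAB && !xAc)) && (!yBc && zAc))
  + bI ((xAc && (!xAB && !xBc)) && (yBc && !zAc))
  - bI ((!xAB && (!xAc && !xBc)) && (!yBc && !zAc))
  - bI ((!xAB && (!xAc && !yA)) && zAc)
  - bI (yBc && (!xAB && (!zB && !xBc)))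
  + bI ((!xAB && (!xAc && yA)) && (!s3a && !s3b))
  + bI ((!s4a && !s4b) && (!xAc && !xBc))

set_option synthInstance.maxHeartbeats 200000 in
set_option synthInstance.maxSize 2048 in
/-- **The certificate is pointwise nonpositive** on every Boolean pattern of the eleven atoms compatible with the
seven implications supplied by transitivity through `c` and the cluster facts (`2¹¹` cases, by `decide`). [this work] -/
theorem certB_nonpos : ∀ xAB xAc xBc yBc zAc yA zB s3a s3b s4a s4b : Bool,
    (xAc = true → xBc = true → xAB = true) → (yA = true → yBc = true) → (zB = true → zAc = true) →
    (xAB = true → xAc = false → s4a = true) → (xBc = true → xAB = false → s3b = true) →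
    (zB = true → s3a = true) → (yA = true → s4b = true) →
    certB xAB xAc xBc yBc zAc yA zB s3a s3b s4a s4b ≤ 0 := by
  decide +kernel

/-- **Pointwise lemma, propositional form** (FINDING-GRP3PTLB.md §3 with the cluster facts abstracted): for any
eleven propositions satisfying the seven implications, the certificate expression is `≤ 0`. [this work] -/
theorem certP_nonpos (xAB xAc xBc yBc zAc yA zB s3a s3b s4a s4b : Prop)
    (h1 : xAc → xBc → xAB) (h2 : yA → yBc) (h3 : zB → zAc) (h4 : xAB → ¬xAc → s4a)
    (h5 : xBc → ¬xAB → s3b) (h6 : zB → s3a) (h7 : yA → s4b) :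
    pind ((xBc ∧ ¬xAB ∧ ¬xAc) ∧ ¬yBc ∧ zAc)
    + pind ((xAc ∧ ¬xAB ∧ ¬xBc) ∧ yBc ∧ ¬zAc)
    - pind ((¬xAB ∧ ¬xAc ∧ ¬xBc) ∧ ¬yBc ∧ ¬zAc)
    - pind ((¬xAB ∧ ¬xAc ∧ ¬yA) ∧ zAc)
    - pind (yBc ∧ ¬xAB ∧ ¬zB ∧ ¬xBc)
    + pind ((¬xAB ∧ ¬xAc ∧ yA) ∧ ¬s3a ∧ ¬s3b)
    + pind ((¬s4a ∧ ¬s4b) ∧ ¬xAc ∧ ¬xBc) ≤ 0 := by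
  classical
  have key := certB_nonpos (decide xAB) (decide xAc) (decide xBc) (decide yBc) (decide zAc) (decide yA)
      (decide zB) (decide s3a) (decide s3b) (decide s4a) (decide s4b)
      (by simpa only [decide_eq_true_eq] using h1) (by simpa only [decide_eq_true_eq] using h2)
      (by simpa only [decide_eq_true_eq] using h3)
      (by simpa only [decide_eq_true_eq, decide_eq_false_iff_not] using h4)
      (by simpa only [decide_eq_true_eq, decide_eq_false_iff_not] using h5)
      (by simpa only [decide_eq_true_eq] using h6) (by simpa only [decide_eq_true_eq] using h7)
  rw [pind_eq_bI, pind_eq_bI, pind_eq_bI, pind_eq_bI, pind_eq_bI, pind_eq_bI, pind_eq_bI]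
  simp only [Bool.decide_and, decide_not]
  unfold certB at key
  exact_mod_cast key

/-! ### The cubic identity -/

/-- The cubic identity `E[S] = −E₃` of `GRP3PTLB` (FINDING-GRP3PTLB.md §2), as a FREE polynomial identity:
`q = P(Q)`, `sA = P(D[A|B] ∩ D[A|c])`, `sB = P(D[A|B] ∩ D[B|c])`, `sC = P(D[A|c] ∩ D[B|c])`, `x = P(D[B|c])`,
`y = P(D[A|c])`, with `P(Pa) = sA − q`, `P(Pb) = sB − q` and `P(D[A|B]) = sA + sB − q` substituted. [this work] -/
theorem cert_identity (q sA sB sC x y : ℝ) :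
    (sA - q) * x * (1 - y) + (sB - q) * (1 - x) * y - q * x * y
      - 1 * q * (1 - y) - 1 * (1 - x) * q + 1 * (sA - q) * sC + 1 * sB * sC =
    -(2 * q + (sA + sB - q) * y * x - ((sA + sB - q) * sC + y * sB + x * sA)) := by
  ring

end GroupThreePointLB

end Summit.CriticalPhenomena.PercolationContinuityZ3.Theorems

end
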